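import Summits.QuantumFields.YangMills.Theorems.FluctuationComparisonRegPrIntLS2BetaHFlatOfRelativeLetter
import HarnessLib

/-!
# S2β · `hFlat` road (UV3-NODE §57.8 (B)) — THE HYPOTHESIS (H) OF ✓p816498 FROM ITS FOUR FEEDERS AND THE SUP BUDGET:
# «one-level relative letter in ℓ²» ⟸ {F2 the (ii-b) ℓ² letter, F1 the KEY LEMMA, F3 the flap letter in ℓ², F4 the corr letter in ℓ², S the sup budget}

Cell `ym3-torus` (YM ladder rung R3 = continuum `SU(2)` Yang–Mills on the three-torus — a RUNG: NOT d = 4, NOT infinite volume, NOT a mass gap,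
NOT Clay).  Width seat «width 17» `ym3-torus-px17` (gen 19), FREE px helper on crux `stmt-QuantumFields-20520`
(`Theses.UnitScaleTilt.FluctuationComparisonRegPrIntL`); `--kind proof --supports stmt-QuantumFields-20520 --as helper`, count-neutral, DEFINITION-FREE
(0 `def`, 0 `instance`, 0 `notation`, 0 `sorry`, default heartbeats); pure ℓ² algebra over the door ✓p816498 `…HFlatOfRelativeLetter`.

WHY.  ✓p816498 `hFlat_of_letter` reduces the registered `hFlat` letter to ONE displayed hypothesis (H) «the one-level relative letter in ℓ²» (+ a lift
with (R1)), and names its four feeders.  All four now have KERNEL SHAPES: F2 = px13 g22 ✓p816657 `sq_sum_le_plaq` (`Σ_b dist1(W b·U₀ b⁻¹)² ≤ 2·Cs·(ΣW∂² +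
ΣU₀∂²) + CL·Σspine²`, `hax` = (T4) of ✓p816142); F1 = px8 g21's G11 `keyLemma_tower_sqrtL` shape (`‖dist1 (M^tU)(∂·)‖₂ ≤ Kc·(√L)^t·‖dist1 U(∂·)‖₂`; px12 g23
✓p816714 `tentKernel_schur` supplies its row∕column counts); F3 = px12 g23's `sum_plaq_dist1_lift_sq_le` (✓-pending 08:37Z: `ΣV∂² ≤ L^{−4}·L^d·(π²·ΣX∂² +
6912(d−1)·s²·Σarc(X)²)`, one `√(a+b) ≤ √a + √b` away from the linear form used here); F4 = px10 g22's corr letter in ℓ² (`‖spine‖₂ ≤ C_c·‖dist1 W(∂·)‖₂`,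
typing); S = ✓p8167xx `…RelativeTowerSupProfile.exists_supProfile_relativeTower` ∘ px16 g20 ✓p816768 `sup_bootstrap`∕`linearised_of_bootstrap` (the sup
profile `s`, `0 ≤ s`, `Σ_{t<m} s_{t+1} ≤ Sbud`).  THIS FILE turns {F1, F2, F3, F4, S} — each as a displayed hypothesis in its supplier's currency, with
ABSTRACT nonnegative constants `Cs CL Kc C_F C_S C_c Sbud` — into (H) VERBATIM (the clause `dockB_inner`∕`hFlat_of_letter` consume), with EXPLICIT
    `e_t := (π∕2)·√(2Cs)·C_S·s_{t+1}∕√L`,   `E := (π∕2)·√(2Cs)·C_S·Sbud∕√L`,   `C := Kc·(√(2Cs)·(1 + C_F·√L) + √CL·C_c)`.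
* §1 `sqrt_add_le_sqrt_add_sqrt_real`.
* §2 ★★ `relLetter_level` — one level over abstract nonnegative reals: F2 ∧ F1 ∧ F3 ∧ F4 ⟹ `(π∕2)·√Rel ≤ (π∕2)·(√(2Cs)·(a₁ + C_F·a₂ + C_S·σ·Bn) + √CL·C_c·a₁)`.
* §3 ★★★ `relLetter_of_feeders` — along the tower objects of (H) (`U′_t := g_t • M^tU`, `V_t := lift_t U′_{t+1}`, the (0.4) average `blockAvg ℰp`): the
  plaquette `dist1`s of `U′_t` ARE those of `M^tU` (lit ✓`T4ReTrLipUnitary.plaqHol_gaugeAct` + `dist1_conj`), so F1 is read on the gauged levels; then §2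
  level by level; the `√L` bookkeeping puts the SIZE × ARC term of F3 into (H)'s `√L·e_t·B_{t+1}` slot and everything else into `C·(√L)^t·‖dist1 U(∂·)‖₂`.

SO, BY KERNEL (✓p816498 ∘ this file): the registered `hFlat` ⟸ {F1 KEY LEMMA, F3 flap-ℓ², F4 corr-ℓ², S sup budget} ∧ F2 (✓ landed) ∧ (R1) (✓ landed) — every
remaining input named in its supplier's own currency.  Nothing here bounds anything: the five hypotheses carry all the analysis.

HONEST SCOPE.  Elementary real∕ℓ² algebra; nothing of Bałaban's analysis is asserted or proved ([Balaban1984PropagatorsI] Prop. 1.1 (1.89)–(1.90) p.33 is the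
printed locus of the quadratic floor; [Balaban1985RegularSpaces] (1.29) p.81 the geodesic interpolation); F1, F3, F4, S are undischarged HYPOTHESES here; (H),
`hFlat`, TUBE-REG∘, GAP♯∘ (`stub_uniformFibreGapOrbit`), EXW∘, DET-REP-B, S2β, crux 20520, 19936, 19200 and `YM3TorusSU2` are NOT proved; no registered stub is
closed; rung R3 = SU(2) YM₃ on T³ at fixed lattice data — NOT d = 4, NOT infinite volume, NOT a mass gap, NOT Clay; the Yang–Mills mass gap is NOT proved.
References: T. Bałaban, CMP **95** (1984) 17–40 [Balaban1984PropagatorsI]; CMP **99** (1985) 75–102 [Balaban1985RegularSpaces] ((1.29) p.81).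
-/

set_option autoImplicit false

noncomputable section

namespace Summit.QuantumFields.YangMills.Theorems.FluctuationComparisonRegPrIntLS2BetaHFlatOfFeeders

open Finset
open scoped Real
open Literature.MathematicalPhysics.QuantumLattice (su2Quat)
open Literature.MathematicalPhysics.QuantumFieldTheory.Balaban1983to89
open T4Continuum T3ContinuumYM3Torus BlockAveraging
open T4CubeChartGnomonic (SU2)
open T4ExpWindowSmallField (logVec)
open B10Eq27TorusAxialLog (axialT)

/-! ## §1 Square roots -/

/-- `√(a + b) ≤ √a + √b`. [folklore] -/
theorem sqrt_add_le_sqrt_add_sqrt_real (a b : ℝ) : √(a + b) ≤ √a + √b := by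
  rcases le_or_gt 0 a with ha | ha
  · rcases le_or_gt 0 b with hb | hb
    · rw [Real.sqrt_le_left (by positivity)]
      nlinarith [Real.sq_sqrt ha, Real.sq_sqrt hb, Real.sqrt_nonneg a, Real.sqrt_nonneg b]
    · rw [Real.sqrt_eq_zero'.mpr hb.le, add_zero]
      exact Real.sqrt_le_sqrt (by linarith)
  · rw [Real.sqrt_eq_zero'.mpr ha.le, zero_add]
    exact Real.sqrt_le_sqrt (by linarith)

/-! ## §2 The relative letter in ℓ² at ONE level from the four feeders -/

/-- ★★ **ONE LEVEL**: abstract nonnegative quantities — `Rel` (the relative field's ℓ² mass), `A` (plaquettes of the current field), `B` (plaquettes of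
the lift), `D` (spine quotients), `Bn` (arc energy of the coarser field), `Fl` (finest fluxes) — with F2 `Rel ≤ 2·Cs·(A + B) + CL·D`, F1 `√A ≤ a₁`,
F3 `√B ≤ C_F·a₂ + C_S·σ·Bn`, F4 `√D ≤ C_c·√A` ⟹ `(π∕2)·√Rel ≤ (π∕2)·(√(2Cs)·(a₁ + C_F·a₂ + C_S·σ·Bn) + √CL·C_c·a₁)`. [folklore] -/
theorem relLetter_level {Rel A B D Bn a₁ a₂ σ Cs CL C_F C_S C_c : ℝ} (hCs : 0 ≤ Cs) (hCL : 0 ≤ CL) (hCc : 0 ≤ C_c)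
    (hF2 : Rel ≤ 2 * Cs * (A + B) + CL * D) (hF1 : √A ≤ a₁) (hF3 : √B ≤ C_F * a₂ + C_S * σ * Bn) (hF4 : √D ≤ C_c * √A) :
    π / 2 * √Rel ≤ π / 2 * (√(2 * Cs) * (a₁ + C_F * a₂ + C_S * σ * Bn) + √CL * C_c * a₁) := by
  have hπ : 0 ≤ π / 2 := by positivity
  refine mul_le_mul_of_nonneg_left ?_ hπ
  have h1 : √Rel ≤ √(2 * Cs * (A + B) + CL * D) := Real.sqrt_le_sqrt hF2
  have h2 : √(2 * Cs * (A + B) + CL * D) ≤ √(2 * Cs * (A + B)) + √(CL * D) := sqrt_add_le_sqrt_add_sqrt_real _ _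
  have h3 : √(2 * Cs * (A + B)) ≤ √(2 * Cs) * (√A + √B) := by
    rw [Real.sqrt_mul (by positivity)]
    exact mul_le_mul_of_nonneg_left (sqrt_add_le_sqrt_add_sqrt_real A B) (Real.sqrt_nonneg _)
  have h4 : √(CL * D) = √CL * √D := Real.sqrt_mul hCL D
  have h5 : √CL * √D ≤ √CL * (C_c * √A) := mul_le_mul_of_nonneg_left hF4 (Real.sqrt_nonneg _)
  have h6 : √CL * (C_c * √A) ≤ √CL * (C_c * a₁) :=
    mul_le_mul_of_nonneg_left (mul_le_mul_of_nonneg_left hF1 hCc) (Real.sqrt_nonneg _)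
  have h7 : √(2 * Cs) * (√A + √B) ≤ √(2 * Cs) * (a₁ + (C_F * a₂ + C_S * σ * Bn)) :=
    mul_le_mul_of_nonneg_left (add_le_add hF1 hF3) (Real.sqrt_nonneg _)
  calc √Rel ≤ √(2 * Cs * (A + B)) + √(CL * D) := h1.trans h2
    _ ≤ √(2 * Cs) * (a₁ + (C_F * a₂ + C_S * σ * Bn)) + √CL * (C_c * a₁) := by rw [h4]; exact add_le_add (h3.trans h7) (h5.trans h6)
    _ = √(2 * Cs) * (a₁ + C_F * a₂ + C_S * σ * Bn) + √CL * C_c * a₁ := by ring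

/-! ## §3 THE (H) CLAUSE OF ✓p816498 FROM THE FEEDERS along a tower -/

variable (F : T3Family) {J K : ℕ}

/-- ★★★ **(H) FROM ITS FEEDERS** (one run pair; the clause of ✓p816498 `dockB_inner`∕`hFlat_of_letter` for ONE gauge family `g` — the caller threads
the tower antecedents).  With `U′_t := g_t • M^tU`, `V_t := lift_t U′_{t+1}`, `Fl := ‖dist1 U(∂·)‖₂`, `B_t := ‖arc U′_t‖₂`:
F2 `Σ_b dist1(U′_t b·V_t b⁻¹)² ≤ 2·Cs·(‖dist1 U′_t(∂·)‖₂² + ‖dist1 V_t(∂·)‖₂²) + CL·‖spine_t‖₂²` (px13 g22 ✓p816657 `sq_sum_le_plaq`, `hax` = (T4));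
F1 `‖dist1 (M^tU)(∂·)‖₂ ≤ Kc·(√L)^t·Fl` (KEY LEMMA, px8 g21 §64∕G11 `keyLemma_tower_sqrtL`) — and `‖dist1 U′_t(∂·)‖₂ = ‖dist1 (M^tU)(∂·)‖₂` by
gauge invariance (lit ✓`dist1_plaqHol_gaugeAct`); F3 `‖dist1 V_t(∂·)‖₂ ≤ C_F·‖dist1 U′_{t+1}(∂·)‖₂ + C_S·s_{t+1}·B_{t+1}` (flap letter in ℓ², SIZE × ARC;
px12 g23 ✓p816227 + locality); F4 `‖spine_t‖₂ ≤ C_c·‖dist1 U′_t(∂·)‖₂` (corr letter in ℓ²; px10 g22); S `0 ≤ s`, `Σ_{t<K−J} s_{t+1} ≤ Sbud` (sup budget: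
✓`…RelativeTowerSupProfile` §4 ∘ px16 g20's bootstrap ∘ ✓`thresholdSum_small`).  THEN (H): `e_t := (π∕2)·√(2Cs)·C_S·s_{t+1}∕√L`,
`E := (π∕2)·√(2Cs)·C_S·Sbud∕√L`, `C := Kc·(√(2Cs)·(1 + C_F·√L) + √CL·C_c)` (the `π∕2` kept outside as in (H)). [cite: Balaban1985RegularSpaces, (1.29) p.81; Balaban1984PropagatorsI, Prop. 1.1 (1.89)-(1.90) p.33] -/
theorem relLetter_of_feeders (hL : 1 < (F.L : ℝ)) (U : GaugeField (F.P K) 0 SU2)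
    (lift : (j : ℕ) → GaugeField (F.P K) (j + 1) SU2 → GaugeField (F.P K) j SU2)
    (g : (j : ℕ) → Site (F.P K) j → SU2)
    {Cs CL Kc C_F C_S C_c Sbud : ℝ} (hCs : 0 ≤ Cs) (hCL : 0 ≤ CL) (hCF : 0 ≤ C_F) (hCS : 0 ≤ C_S) (hCc : 0 ≤ C_c)
    (s : ℕ → ℝ) (hs0 : ∀ t, 0 ≤ s t) (hS : ∑ t ∈ range (K - J), s (t + 1) ≤ Sbud)
    (hF2 : ∀ t, t < K - J →
      ∑ b, dist1 (GaugeField.gaugeAct (g t) (Averaging.iter (fun k => blockAvg (P := F.P K) (j := k) T3UnitLawDensityEML.ℰp) t U) b *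
          (lift t (GaugeField.gaugeAct (g (t + 1)) (Averaging.iter (fun k => blockAvg (P := F.P K) (j := k) T3UnitLawDensityEML.ℰp) (t + 1) U)) b)⁻¹) ^ 2 ≤
        2 * Cs * (∑ p, dist1 (GaugeField.plaqHol (GaugeField.gaugeAct (g t)
              (Averaging.iter (fun k => blockAvg (P := F.P K) (j := k) T3UnitLawDensityEML.ℰp) t U)) p) ^ 2 +
            ∑ p, dist1 (GaugeField.plaqHol (lift t (GaugeField.gaugeAct (g (t + 1))
              (Averaging.iter (fun k => blockAvg (P := F.P K) (j := k) T3UnitLawDensityEML.ℰp) (t + 1) U))) p) ^ 2) +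
          CL * ∑ c, dist1 (AveragingRT.axialAvg (GaugeField.gaugeAct (g t)
              (Averaging.iter (fun k => blockAvg (P := F.P K) (j := k) T3UnitLawDensityEML.ℰp) t U)) c *
            (AveragingRT.axialAvg (lift t (GaugeField.gaugeAct (g (t + 1))
              (Averaging.iter (fun k => blockAvg (P := F.P K) (j := k) T3UnitLawDensityEML.ℰp) (t + 1) U))) c)⁻¹) ^ 2)
    (hF1 : ∀ t, t ≤ K - J →
      √(∑ p, dist1 (GaugeField.plaqHol (Averaging.iter (fun k => blockAvg (P := F.P K) (j := k) T3UnitLawDensityEML.ℰp) t U) p) ^ 2) ≤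
        Kc * Real.sqrt (F.L : ℝ) ^ t * √(∑ p, dist1 (GaugeField.plaqHol U p) ^ 2))
    (hF3 : ∀ t, t < K - J →
      √(∑ p, dist1 (GaugeField.plaqHol (lift t (GaugeField.gaugeAct (g (t + 1))
          (Averaging.iter (fun k => blockAvg (P := F.P K) (j := k) T3UnitLawDensityEML.ℰp) (t + 1) U))) p) ^ 2) ≤
        C_F * √(∑ p, dist1 (GaugeField.plaqHol (GaugeField.gaugeAct (g (t + 1))
            (Averaging.iter (fun k => blockAvg (P := F.P K) (j := k) T3UnitLawDensityEML.ℰp) (t + 1) U)) p) ^ 2) +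
          C_S * s (t + 1) * √(∑ b, ‖logVec (su2Quat (GaugeField.gaugeAct (g (t + 1))
            (Averaging.iter (fun k => blockAvg (P := F.P K) (j := k) T3UnitLawDensityEML.ℰp) (t + 1) U) b))‖ ^ 2))
    (hF4 : ∀ t, t < K - J →
      √(∑ c, dist1 (AveragingRT.axialAvg (GaugeField.gaugeAct (g t)
            (Averaging.iter (fun k => blockAvg (P := F.P K) (j := k) T3UnitLawDensityEML.ℰp) t U)) c *
          (AveragingRT.axialAvg (lift t (GaugeField.gaugeAct (g (t + 1))
            (Averaging.iter (fun k => blockAvg (P := F.P K) (j := k) T3UnitLawDensityEML.ℰp) (t + 1) U))) c)⁻¹) ^ 2) ≤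
        C_c * √(∑ p, dist1 (GaugeField.plaqHol (GaugeField.gaugeAct (g t)
            (Averaging.iter (fun k => blockAvg (P := F.P K) (j := k) T3UnitLawDensityEML.ℰp) t U)) p) ^ 2)) :
    ∃ e : ℕ → ℝ, (∀ j, 0 ≤ e j) ∧ ∑ j ∈ range (K - J), e j ≤ π / 2 * √(2 * Cs) * C_S * Sbud / Real.sqrt (F.L : ℝ) ∧
      ∀ j, j < K - J →
        π / 2 * √(∑ b, dist1 (GaugeField.gaugeAct (g j) (Averaging.iter (fun k => blockAvg (P := F.P K) (j := k) T3UnitLawDensityEML.ℰp) j U) b *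
            (lift j (GaugeField.gaugeAct (g (j + 1)) (Averaging.iter (fun k => blockAvg (P := F.P K) (j := k) T3UnitLawDensityEML.ℰp) (j + 1) U)) b)⁻¹) ^ 2) ≤
          Real.sqrt (F.L : ℝ) * (π / 2 * √(2 * Cs) * C_S * s (j + 1) / Real.sqrt (F.L : ℝ)) *
              √(∑ b, ‖logVec (su2Quat (GaugeField.gaugeAct (g (j + 1))
                (Averaging.iter (fun k => blockAvg (P := F.P K) (j := k) T3UnitLawDensityEML.ℰp) (j + 1) U) b))‖ ^ 2) +
            π / 2 * (Kc * (√(2 * Cs) * (1 + C_F * Real.sqrt (F.L : ℝ)) + √CL * C_c)) * Real.sqrt (F.L : ℝ) ^ j *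
              √(∑ p, dist1 (GaugeField.plaqHol U p) ^ 2) := by
  have hLs : 0 < Real.sqrt (F.L : ℝ) := Real.sqrt_pos.mpr (by linarith)
  set av : ∀ i, Averaging (F.P K) i SU2 := fun k => blockAvg (P := F.P K) (j := k) T3UnitLawDensityEML.ℰp with hav
  refine ⟨fun j => π / 2 * √(2 * Cs) * C_S * s (j + 1) / Real.sqrt (F.L : ℝ),
    fun j => div_nonneg (mul_nonneg (mul_nonneg (mul_nonneg (by positivity) (Real.sqrt_nonneg _)) hCS) (hs0 _))
      (Real.sqrt_nonneg _), ?_, ?_⟩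
  · -- the budget
    rw [← sum_div, ← mul_sum]
    exact div_le_div_of_nonneg_right (mul_le_mul_of_nonneg_left hS (by positivity)) hLs.le
  · intro j hj
    -- gauge invariance of the current field's plaquettes
    have hgi : ∑ p, dist1 (GaugeField.plaqHol (GaugeField.gaugeAct (g j) (Averaging.iter av j U)) p) ^ 2 =
        ∑ p, dist1 (GaugeField.plaqHol (Averaging.iter av j U) p) ^ 2 :=
      sum_congr rfl fun p _ => by rw [T4ReTrLipUnitary.plaqHol_gaugeAct, GaugeGroup.dist1_conj]
    have hgi' : ∑ p, dist1 (GaugeField.plaqHol (GaugeField.gaugeAct (g (j + 1)) (Averaging.iter av (j + 1) U)) p) ^ 2 =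
        ∑ p, dist1 (GaugeField.plaqHol (Averaging.iter av (j + 1) U) p) ^ 2 :=
      sum_congr rfl fun p _ => by rw [T4ReTrLipUnitary.plaqHol_gaugeAct, GaugeGroup.dist1_conj]
    -- F1 at j and j+1, read on the gauged fields
    have hA : √(∑ p, dist1 (GaugeField.plaqHol (GaugeField.gaugeAct (g j) (Averaging.iter av j U)) p) ^ 2) ≤
        Kc * Real.sqrt (F.L : ℝ) ^ j * √(∑ p, dist1 (GaugeField.plaqHol U p) ^ 2) := by rw [hgi]; exact hF1 j hj.le
    have hA' : √(∑ p, dist1 (GaugeField.plaqHol (GaugeField.gaugeAct (g (j + 1)) (Averaging.iter av (j + 1) U)) p) ^ 2) ≤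
        Kc * Real.sqrt (F.L : ℝ) ^ (j + 1) * √(∑ p, dist1 (GaugeField.plaqHol U p) ^ 2) := by rw [hgi']; exact hF1 (j + 1) (by omega)
    -- F3 with F1 inserted
    have hB : √(∑ p, dist1 (GaugeField.plaqHol (lift j (GaugeField.gaugeAct (g (j + 1)) (Averaging.iter av (j + 1) U))) p) ^ 2) ≤
        C_F * (Kc * Real.sqrt (F.L : ℝ) ^ (j + 1) * √(∑ p, dist1 (GaugeField.plaqHol U p) ^ 2)) +
          C_S * s (j + 1) * √(∑ b, ‖logVec (su2Quat (GaugeField.gaugeAct (g (j + 1)) (Averaging.iter av (j + 1) U) b))‖ ^ 2) :=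
      (hF3 j hj).trans (add_le_add (mul_le_mul_of_nonneg_left hA' hCF) le_rfl)
    have hlev := relLetter_level (Rel := ∑ b, dist1 (GaugeField.gaugeAct (g j) (Averaging.iter av j U) b *
        (lift j (GaugeField.gaugeAct (g (j + 1)) (Averaging.iter av (j + 1) U)) b)⁻¹) ^ 2)
      hCs hCL hCc (hF2 j hj) hA hB (hF4 j hj)
    refine hlev.trans (le_of_eq ?_)
    have hne : Real.sqrt (F.L : ℝ) ≠ 0 := hLs.ne'
    have hmd : Real.sqrt (F.L : ℝ) * (π / 2 * √(2 * Cs) * C_S * s (j + 1) / Real.sqrt (F.L : ℝ)) =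
        π / 2 * √(2 * Cs) * C_S * s (j + 1) := mul_div_cancel₀ _ hne
    rw [hmd, pow_succ]
    ring

end Summit.QuantumFields.YangMills.Theorems.FluctuationComparisonRegPrIntLS2BetaHFlatOfFeeders

end
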